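import Summits.QuantumFields.YangMills.Theorems.ColdStartUniversalityLindebergSwapSmallFieldContinuity
import Summits.QuantumFields.YangMills.Theorems.ColdStartUniversalityLatticeLangevinStochasticContinuity
import HarnessLib

/-!
# Crux `ColdStartContinuumCauchy` (stmt-QuantumFields-24810, route `ColdStartUniversality`), LINE 3 «lindeberg_swap»:
# THE COLD-WINDOW SHORT-WINDOW SWAP — the rung `ShortWindowSwap` AT `t₀ = 0`, proved

Helper file (seat `ym-line-csu-p1`, g9; `--supports stmt-QuantumFields-24810`).  The registered rung `stub_shortWindowSwap` asks, at ONE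
cut-off `K`, for the one-window swap error `|E g(stepDown U'((t₀+τ)/ε')) − E (P_τ g)(stepDown U'(t₀/ε'))| ≤ A δ` for short windows
`τ ≤ τ₀(K, δ)`, UNIFORMLY in `t₀ ∈ [0, T]`, in every `g` of the scale-weighted Lipschitz class `𝒢_K(A)` and in the realisations.  As the
memo `rung-shortWindowSwap-wall.md` (evidence on the crux) explains, the `t₀`-uniform form meets the DISCONTINUITY of the guarded
averaging of record (it needs Haar-nullity of the guard level sets and non-concentration of the cold-start law there).  This file proves
the COLD-WINDOW case `t₀ = 0` (`shortWindowSwap_coldWindow`), where the fine start `U'(0) = 1` and the coarse start `stepDown 1 = 1` sit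
in the interior of the small-field region:

  for `τ ≤ τ₀(F, γ, K, δ)`:  `|E g(stepDown U'((0+τ)/ε_{K+1})) − E (P_τ g)(stepDown U'(0/ε_{K+1}))| ≤ A·δ`

for every fine cold-start solution `U'` (any space), every jointly measurable coarse solution family `V` (any space), every `A`
and `g ∈ 𝒢_K(A)` — literally the registered statement with `t₀ := 0` (the idle `T` dropped).  Proof: for `A < 0` the class is empty
(`TransportPerturbation.exists_wd_pos`); for `A ≥ 0` both terms are within `A·E[wdisc_K(·, 1)]` of `g(1)` (Lipschitz bound), and
`E[wdisc_K(Z, 1)] ≤ η + 4·P(Σ_e‖ρ(Y e) − 1‖_F² ≥ ρ)` (`integral_le_add_mul_measureReal`, with `wdisc ≤ 4` and the small-field continuity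
`exists_hsDist_wdisc_stepDown_one_lt` / `exists_hsDist_wdisc_one_lt`), where `Y = U'(τ/ε')` resp. `V 1 (τ/ε)` start at `1`, so the
uniform stochastic continuity `measureReal_hsDist_start_ge_le` makes the tail `≤ C((τ/ε)² + τ/ε)/ρ ≤ δ/4` for `τ ≤ τ₀`.
THEOREMS ONLY, no definition, no sorry.  HONEST FRAMING: a BC5-type rung in the decided (cold, fixed-K) regime; it is NOT the registered
`stub_shortWindowSwap` (whose `t₀`-uniformity is the open part), NOT `stub_oneWindowSwap` / `stub_scalePropagation` (XL, untouched); no crux,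
rung of record or summit is proved; the Yang–Mills mass gap is NOT proved.
-/

set_option autoImplicit false

noncomputable section

namespace Summit.QuantumFields.YangMills.Cruxes.ColdStartContinuumCauchy.LindebergSwap

open scoped BigOperators NNReal
open MeasureTheory Filter Set
open Literature.MathematicalPhysics.QuantumFieldTheory
open Literature.MathematicalPhysics.QuantumFieldTheory.Balaban1983to89
open Literature.MathematicalPhysics.QuantumLattice

/-! ## Two elementary lemmas -/

/-- **Expectation of a bounded weight that is small on a ball**: if `0 ≤ w ≤ M` and `w z < η` whenever `d z < ρ`, then
`E[w(Z)] ≤ η + M · P(ρ ≤ d(Z))`. [folklore] -/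
theorem integral_le_add_mul_measureReal {Ω X : Type*} [MeasurableSpace Ω] [MeasurableSpace X] {P : Measure Ω}
    [IsProbabilityMeasure P] {Z : Ω → X} (hZ : Measurable Z) {w d : X → ℝ} (hw : Measurable w) (hd : Measurable d)
    {M η ρ : ℝ} (hw0 : ∀ z, 0 ≤ w z) (hwM : ∀ z, w z ≤ M) (hη : 0 ≤ η)
    (hsmall : ∀ z, d z < ρ → w z < η) :
    ∫ ω, w (Z ω) ∂P ≤ η + M * P.real {ω | ρ ≤ d (Z ω)} := by
  have hB : MeasurableSet {ω | ρ ≤ d (Z ω)} := measurableSet_le measurable_const (hd.comp hZ)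
  have hpt : ∀ ω, w (Z ω) ≤ η + M * Set.indicator {ω | ρ ≤ d (Z ω)} (fun _ => (1 : ℝ)) ω := by
    intro ω
    by_cases hω : ρ ≤ d (Z ω)
    · have hmem : ω ∈ {ω | ρ ≤ d (Z ω)} := hω
      rw [Set.indicator_of_mem hmem, mul_one]
      linarith [hwM (Z ω)]
    · have hnmem : ω ∉ {ω | ρ ≤ d (Z ω)} := hω
      rw [Set.indicator_of_notMem hnmem, mul_zero, add_zero]
      exact (hsmall (Z ω) (not_le.mp hω)).le
  have hint_w : Integrable (fun ω => w (Z ω)) P :=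
    (integrable_const M).mono' (hw.comp hZ).aestronglyMeasurable
      (ae_of_all _ fun ω => by rw [Real.norm_eq_abs, abs_of_nonneg (hw0 _)]; exact hwM _)
  have hint_ind : Integrable (fun ω => Set.indicator {ω | ρ ≤ d (Z ω)} (fun _ => (1 : ℝ)) ω) P :=
    (integrable_const (1 : ℝ)).indicator hB
  have hint_rhs : Integrable (fun ω => η + M * Set.indicator {ω | ρ ≤ d (Z ω)} (fun _ => (1 : ℝ)) ω) P :=
    (integrable_const η).add (hint_ind.const_mul M)
  calc ∫ ω, w (Z ω) ∂P ≤ ∫ ω, (η + M * Set.indicator {ω | ρ ≤ d (Z ω)} (fun _ => (1 : ℝ)) ω) ∂P :=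
        integral_mono hint_w hint_rhs hpt
    _ = η + M * P.real {ω | ρ ≤ d (Z ω)} := by
        rw [integral_add (integrable_const η) (hint_ind.const_mul M), integral_const, integral_const_mul,
          integral_indicator_const _ hB]
        simp only [smul_eq_mul, mul_one, probReal_univ, one_mul]

/-- Arithmetic of the window length: `h ≤ 1` and `h ≤ ρ δ / (64 (C+1))` give `4 · (C (h² + h) / ρ) ≤ δ / 4`. [folklore] -/
theorem four_mul_tail_le {C ρ δ h : ℝ} (hC : 0 ≤ C) (hρ : 0 < ρ) (hδ : 0 < δ) (h0 : 0 ≤ h) (h1 : h ≤ 1)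
    (h2 : h ≤ ρ * δ / (64 * (C + 1))) : 4 * (C * (h ^ 2 + h) / ρ) ≤ δ / 4 := by
  have hsq : h ^ 2 + h ≤ 2 * h := by nlinarith
  have hC1 : 0 < C + 1 := by linarith
  have step1 : C * (h ^ 2 + h) / ρ ≤ C * (2 * (ρ * δ / (64 * (C + 1)))) / ρ := by
    gcongr
    exact hsq.trans (by linarith)
  have step2 : C * (2 * (ρ * δ / (64 * (C + 1)))) / ρ = (C / (C + 1)) * (δ / 32) := by
    field_simp
    ring
  have step3 : (C / (C + 1)) * (δ / 32) ≤ 1 * (δ / 32) := by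
    gcongr
    rw [div_le_one hC1]
    linarith
  linarith [step1, step2.le, step3]

/-! ## The cold-window swap -/

/-- ★ **The cold-window short-window swap** (the registered rung `ShortWindowSwap` of LINE 3 «lindeberg_swap» at `t₀ = 0`): for every
family `F`, `γ > 0`, cut-off `K` and `δ > 0` there is `τ₀ > 0` such that for every fine cold-start solution `U'`, every jointly measurable
coarse solution family `V`, every `A` and every `g` in the scale-weighted class `𝒢_K(A)`, and all `0 ≤ τ ≤ τ₀`,
`|E g(stepDown U'((0+τ)/ε_{K+1})) − E (P_{τ/ε_K} g)(stepDown U'(0/ε_{K+1}))| ≤ A·δ`.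
[cite: RevuzYor1999, Ch. IX Thm (1.7)] [cite: Balaban1987RG1, (0.4) p.253] -/
theorem shortWindowSwap_coldWindow :
    ∀ (F : T3ContinuumYM3Torus.T3Family) (γ : ℝ), 0 < γ → ∀ (K : ℕ) (δ : ℝ), 0 < δ →
    ∃ τ₀ : ℝ, 0 < τ₀ ∧
      ∀ (Ω : Type) (_ : MeasurableSpace Ω) (P : Measure Ω) (_ : IsProbabilityMeasure P)
        (W' : ℝ≥0 → Ω → (Edge 3 ((F.P (K + 1)).sitesPerDir 0) × NoiseIdx 2 → ℝ)) (hW' : IsFlatBrownian W' P)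
        (U' : ℝ≥0 → Ω → GaugeConfig 3 ((F.P (K + 1)).sitesPerDir 0) G2), IsColdStartSol F γ (K + 1) P W' hW' U' →
        ∀ (Ω₂ : Type) (_ : MeasurableSpace Ω₂) (P₂ : Measure Ω₂) (_ : IsProbabilityMeasure P₂)
          (W₂ : ℝ≥0 → Ω₂ → (Edge 3 ((F.P K).sitesPerDir 0) × NoiseIdx 2 → ℝ)) (hW₂ : IsFlatBrownian W₂ P₂)
          (V : GaugeConfig 3 ((F.P K).sitesPerDir 0) G2 → ℝ≥0 → Ω₂ → GaugeConfig 3 ((F.P K).sitesPerDir 0) G2),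
          IsSolFamily F γ K P₂ W₂ hW₂ V →
          ∀ (A : ℝ) (g : GaugeConfig 3 ((F.P K).sitesPerDir 0) G2 → ℝ), InCls F K A g →
            ∀ τ : ℝ, 0 ≤ τ → τ ≤ τ₀ →
              |(∫ ω, g (stepDown F K (U' ((0 + τ) / (F.P (K + 1)).eps).toNNReal ω)) ∂P) -
                  ∫ ω, markovTransition V P₂ (τ / (F.P K).eps).toNNReal g
                    (stepDown F K (U' (0 / (F.P (K + 1)).eps).toNNReal ω)) ∂P| ≤ A * δ := by
  intro F γ hγ K δ hδ
  classical
  -- the two lattices, spacings and the stochastic-continuity / small-field constants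
  have hε' : 0 < (F.P (K + 1)).eps := (F.P (K + 1)).eps_pos
  have hε : 0 < (F.P K).eps := (F.P K).eps_pos
  obtain ⟨Cf, hCf0, hCf⟩ := Summit.QuantumFields.YangMills.Theorems.ColdStartUniversality.measureReal_hsDist_start_ge_le
    ((F.P (K + 1)).sitesPerDir 0) ((γ * (F.P (K + 1)).eps)⁻¹ / 2)
  obtain ⟨Cc, hCc0, hCc⟩ := Summit.QuantumFields.YangMills.Theorems.ColdStartUniversality.measureReal_hsDist_start_ge_le
    ((F.P K).sitesPerDir 0) ((γ * (F.P K).eps)⁻¹ / 2)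
  have hη : 0 < δ / 4 := by positivity
  obtain ⟨ρf, hρf, hballf⟩ := exists_hsDist_wdisc_stepDown_one_lt F K hη
  obtain ⟨ρc, hρc, hballc⟩ := exists_hsDist_wdisc_one_lt F K hη
  -- the window length
  set τ₀ : ℝ := min (min (F.P (K + 1)).eps (F.P K).eps)
    (min ((F.P (K + 1)).eps * (ρf * δ / (64 * (Cf + 1)))) ((F.P K).eps * (ρc * δ / (64 * (Cc + 1))))) with hτ₀
  have hτ₀pos : 0 < τ₀ := by positivity
  refine ⟨τ₀, hτ₀pos, ?_⟩
  intro Ω mΩ P hP W' hW' U' hU' Ω₂ mΩ₂ P₂ hP₂ W₂ hW₂ V hV A g hg τ hτ0 hττ₀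
  obtain ⟨hU'0, hU'sol⟩ := hU'
  obtain ⟨hgm, hgb, hglip⟩ := hg
  haveI := Summit.QuantumFields.YangMills.Theorems.ColdStartUniversality.secondCountableTopology_su2
  haveI := Summit.QuantumFields.YangMills.Theorems.ColdStartUniversality.borelSpace_config ((F.P K).sitesPerDir 0)
  haveI := Summit.QuantumFields.YangMills.Theorems.ColdStartUniversality.borelSpace_config ((F.P (K + 1)).sitesPerDir 0)
  -- normalise the two time arguments: `(0 + τ)/ε' = τ/ε'`, `U'(0) = 1`, `stepDown 1 = 1`
  have h0 : ((0 : ℝ) / (F.P (K + 1)).eps).toNNReal = 0 := by simp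
  have hSD0 : ∀ ω, stepDown F K (U' ((0 : ℝ) / (F.P (K + 1)).eps).toNNReal ω) = fun _ => 1 := fun ω => by
    rw [h0, hU'0 ω]; exact StepDown.stepDown_one F K
  simp only [zero_add, hSD0, integral_const, smul_eq_mul, probReal_univ, one_mul]
  -- the coarse term is an expectation along the coarse solution from `1`
  have hPτ : markovTransition V P₂ (τ / (F.P K).eps).toNNReal g (fun _ => 1) =
      ∫ ω, g (V (fun _ => 1) (τ / (F.P K).eps).toNNReal ω) ∂P₂ := rfl
  rw [hPτ]
  -- the empty class for `A < 0`
  rcases lt_or_ge A 0 with hAneg | hA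
  · exfalso
    obtain ⟨u, v, huv⟩ := Summit.QuantumFields.YangMills.Theorems.TransportPerturbation.exists_wd_pos F K
    have h1 : |g u - g v| ≤ A * wdisc F K u v := hglip u v
    have h2 : A * wdisc F K u v < 0 := mul_neg_of_neg_of_pos hAneg huv
    linarith [abs_nonneg (g u - g v)]
  -- names
  set tf : ℝ≥0 := (τ / (F.P (K + 1)).eps).toNNReal with htf
  set tc : ℝ≥0 := (τ / (F.P K).eps).toNNReal with htc
  have hmXf : Measurable (U' tf) := (hU'sol.adapted tf).mono (hW'.natFiltration.le tf) le_rfl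
  have hV1 := hV.1 (fun _ => 1)
  have hmYc : Measurable (V (fun _ => 1) tc) := (hV1.2.adapted tc).mono (hW₂.natFiltration.le tc) le_rfl
  -- Lipschitz bound against `g 1` on both sides
  have hLf : |(∫ ω, g (stepDown F K (U' tf ω)) ∂P) - g (fun _ => 1)| ≤
      A * ∫ ω, wdisc F K (stepDown F K (U' tf ω)) (fun _ => 1) ∂P := by
    have hmeas : Measurable fun ω => g (stepDown F K (U' tf ω)) := hgm.comp ((measurable_stepDown F K).comp hmXf)
    have hint : Integrable (fun ω => g (stepDown F K (U' tf ω))) P :=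
      (integrable_const (1 : ℝ)).mono' hmeas.aestronglyMeasurable (ae_of_all _ fun ω => by
        rw [Real.norm_eq_abs]; exact hgb _)
    have hwm : Measurable fun ω => wdisc F K (stepDown F K (U' tf ω)) (fun _ => 1) :=
      (measurable_wdisc_stepDown_one F K).comp hmXf
    have hwint : Integrable (fun ω => A * wdisc F K (stepDown F K (U' tf ω)) (fun _ => 1)) P :=
      ((integrable_const (4 : ℝ)).mono' hwm.aestronglyMeasurable (ae_of_all _ fun ω => by
        rw [Real.norm_eq_abs, abs_of_nonneg (wdisc_nonneg_le_four F K _ _).1]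
        exact (wdisc_nonneg_le_four F K _ _).2)).const_mul A
    rw [show (∫ ω, g (stepDown F K (U' tf ω)) ∂P) - g (fun _ => 1) =
        ∫ ω, (g (stepDown F K (U' tf ω)) - g (fun _ => 1)) ∂P by
      rw [integral_sub hint (integrable_const _), integral_const, smul_eq_mul, probReal_univ, one_mul]]
    refine (abs_integral_le_integral_abs).trans ?_
    rw [← integral_const_mul]
    exact integral_mono_of_nonneg (ae_of_all _ fun ω => abs_nonneg _) hwint
      (ae_of_all _ fun ω => hglip _ _)
  have hLc : |g (fun _ => 1) - ∫ ω, g (V (fun _ => 1) tc ω) ∂P₂| ≤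
      A * ∫ ω, wdisc F K (V (fun _ => 1) tc ω) (fun _ => 1) ∂P₂ := by
    have hmeas : Measurable fun ω => g (V (fun _ => 1) tc ω) := hgm.comp hmYc
    have hint : Integrable (fun ω => g (V (fun _ => 1) tc ω)) P₂ :=
      (integrable_const (1 : ℝ)).mono' hmeas.aestronglyMeasurable (ae_of_all _ fun ω => by
        rw [Real.norm_eq_abs]; exact hgb _)
    have hwm : Measurable fun ω => wdisc F K (V (fun _ => 1) tc ω) (fun _ => 1) :=
      (measurable_wdisc_one F K).comp hmYc
    have hwint : Integrable (fun ω => A * wdisc F K (V (fun _ => 1) tc ω) (fun _ => 1)) P₂ :=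
      ((integrable_const (4 : ℝ)).mono' hwm.aestronglyMeasurable (ae_of_all _ fun ω => by
        rw [Real.norm_eq_abs, abs_of_nonneg (wdisc_nonneg_le_four F K _ _).1]
        exact (wdisc_nonneg_le_four F K _ _).2)).const_mul A
    rw [abs_sub_comm, show (∫ ω, g (V (fun _ => 1) tc ω) ∂P₂) - g (fun _ => 1) =
        ∫ ω, (g (V (fun _ => 1) tc ω) - g (fun _ => 1)) ∂P₂ by
      rw [integral_sub hint (integrable_const _), integral_const, smul_eq_mul, probReal_univ, one_mul]]
    refine (abs_integral_le_integral_abs).trans ?_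
    rw [← integral_const_mul]
    exact integral_mono_of_nonneg (ae_of_all _ fun ω => abs_nonneg _) hwint
      (ae_of_all _ fun ω => hglip _ _)
  -- expectations of the discrepancies: small on the ball, `≤ 4` off it
  have hdm : ∀ (N : ℕ) [NeZero N], Measurable fun u : GaugeConfig 3 N G2 =>
      ∑ e, hsForm 2 ((fundamentalRep (Fin 2) (u e) : Matrix (Fin 2) (Fin 2) ℂ) - fundamentalRep (Fin 2) (1 : G2))
        ((fundamentalRep (Fin 2) (u e) : Matrix (Fin 2) (Fin 2) ℂ) - fundamentalRep (Fin 2) (1 : G2)) := by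
    intro N _
    exact (Summit.QuantumFields.YangMills.Theorems.ColdStartUniversality.continuous_hsDist (L := N)
      continuous_id (continuous_const (y := fun _ => (1 : G2)))).measurable
  have hEf : ∫ ω, wdisc F K (stepDown F K (U' tf ω)) (fun _ => 1) ∂P ≤
      δ / 4 + 4 * P.real {ω | ρf ≤ ∑ e, hsForm 2
        ((fundamentalRep (Fin 2) (U' tf ω e) : Matrix (Fin 2) (Fin 2) ℂ) - fundamentalRep (Fin 2) (1 : G2))
        ((fundamentalRep (Fin 2) (U' tf ω e) : Matrix (Fin 2) (Fin 2) ℂ) - fundamentalRep (Fin 2) (1 : G2))} :=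
    integral_le_add_mul_measureReal hmXf (measurable_wdisc_stepDown_one F K) (hdm _)
      (fun z => (wdisc_nonneg_le_four F K _ _).1) (fun z => (wdisc_nonneg_le_four F K _ _).2) hη.le hballf
  have hEc : ∫ ω, wdisc F K (V (fun _ => 1) tc ω) (fun _ => 1) ∂P₂ ≤
      δ / 4 + 4 * P₂.real {ω | ρc ≤ ∑ e, hsForm 2
        ((fundamentalRep (Fin 2) (V (fun _ => 1) tc ω e) : Matrix (Fin 2) (Fin 2) ℂ) - fundamentalRep (Fin 2) (1 : G2))
        ((fundamentalRep (Fin 2) (V (fun _ => 1) tc ω e) : Matrix (Fin 2) (Fin 2) ℂ) - fundamentalRep (Fin 2) (1 : G2))} :=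
    integral_le_add_mul_measureReal hmYc (measurable_wdisc_one F K) (hdm _)
      (fun z => (wdisc_nonneg_le_four F K _ _).1) (fun z => (wdisc_nonneg_le_four F K _ _).2) hη.le hballc
  -- the tails, by uniform stochastic continuity from the start `1`
  have hTf := hCf (fun _ => 1) Ω P W' hW' U' hU'0 hU'sol tf ρf hρf
  have hTc := hCc (fun _ => 1) Ω₂ P₂ W₂ hW₂ (V fun _ => 1) hV1.1 hV1.2 tc ρc hρc
  -- window arithmetic
  have htf_val : (tf : ℝ) = τ / (F.P (K + 1)).eps := Real.coe_toNNReal _ (div_nonneg hτ0 hε'.le)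
  have htc_val : (tc : ℝ) = τ / (F.P K).eps := Real.coe_toNNReal _ (div_nonneg hτ0 hε.le)
  have hτ1 : τ ≤ (F.P (K + 1)).eps := hττ₀.trans ((min_le_left _ _).trans (min_le_left _ _))
  have hτ2 : τ ≤ (F.P K).eps := hττ₀.trans ((min_le_left _ _).trans (min_le_right _ _))
  have hτ3 : τ ≤ (F.P (K + 1)).eps * (ρf * δ / (64 * (Cf + 1))) := hττ₀.trans ((min_le_right _ _).trans (min_le_left _ _))
  have hτ4 : τ ≤ (F.P K).eps * (ρc * δ / (64 * (Cc + 1))) := hττ₀.trans ((min_le_right _ _).trans (min_le_right _ _))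
  have hf1 : (tf : ℝ) ≤ 1 := by rw [htf_val, div_le_one hε']; exact hτ1
  have hc1 : (tc : ℝ) ≤ 1 := by rw [htc_val, div_le_one hε]; exact hτ2
  have hf2 : (tf : ℝ) ≤ ρf * δ / (64 * (Cf + 1)) := by rw [htf_val, div_le_iff₀ hε']; linarith
  have hc2 : (tc : ℝ) ≤ ρc * δ / (64 * (Cc + 1)) := by rw [htc_val, div_le_iff₀ hε]; linarith
  have hAf := four_mul_tail_le hCf0 hρf hδ (NNReal.coe_nonneg tf) hf1 hf2
  have hAc := four_mul_tail_le hCc0 hρc hδ (NNReal.coe_nonneg tc) hc1 hc2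
  -- assemble
  have hT1 : |(∫ ω, g (stepDown F K (U' tf ω)) ∂P) - g (fun _ => 1)| ≤ A * (δ / 2) := by
    refine hLf.trans (mul_le_mul_of_nonneg_left ?_ hA)
    have h4 : 4 * P.real {ω | ρf ≤ ∑ e, hsForm 2
        ((fundamentalRep (Fin 2) (U' tf ω e) : Matrix (Fin 2) (Fin 2) ℂ) - fundamentalRep (Fin 2) (1 : G2))
        ((fundamentalRep (Fin 2) (U' tf ω e) : Matrix (Fin 2) (Fin 2) ℂ) - fundamentalRep (Fin 2) (1 : G2))} ≤
        4 * (Cf * (((tf : ℝ≥0) : ℝ) ^ 2 + ((tf : ℝ≥0) : ℝ)) / ρf) :=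
      mul_le_mul_of_nonneg_left hTf (by norm_num : (0 : ℝ) ≤ 4)
    linarith [hEf, h4, hAf]
  have hT2 : |g (fun _ => 1) - ∫ ω, g (V (fun _ => 1) tc ω) ∂P₂| ≤ A * (δ / 2) := by
    refine hLc.trans (mul_le_mul_of_nonneg_left ?_ hA)
    have h4 : 4 * P₂.real {ω | ρc ≤ ∑ e, hsForm 2
        ((fundamentalRep (Fin 2) (V (fun _ => 1) tc ω e) : Matrix (Fin 2) (Fin 2) ℂ) - fundamentalRep (Fin 2) (1 : G2))
        ((fundamentalRep (Fin 2) (V (fun _ => 1) tc ω e) : Matrix (Fin 2) (Fin 2) ℂ) - fundamentalRep (Fin 2) (1 : G2))} ≤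
        4 * (Cc * (((tc : ℝ≥0) : ℝ) ^ 2 + ((tc : ℝ≥0) : ℝ)) / ρc) :=
      mul_le_mul_of_nonneg_left hTc (by norm_num : (0 : ℝ) ≤ 4)
    linarith [hEc, h4, hAc]
  calc |(∫ ω, g (stepDown F K (U' tf ω)) ∂P) - ∫ ω, g (V (fun _ => 1) tc ω) ∂P₂|
      = |((∫ ω, g (stepDown F K (U' tf ω)) ∂P) - g (fun _ => 1)) +
          (g (fun _ => 1) - ∫ ω, g (V (fun _ => 1) tc ω) ∂P₂)| := by ring_nf
    _ ≤ |(∫ ω, g (stepDown F K (U' tf ω)) ∂P) - g (fun _ => 1)| +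
          |g (fun _ => 1) - ∫ ω, g (V (fun _ => 1) tc ω) ∂P₂| := abs_add_le _ _
    _ ≤ A * (δ / 2) + A * (δ / 2) := add_le_add hT1 hT2
    _ = A * δ := by ring

end Summit.QuantumFields.YangMills.Cruxes.ColdStartContinuumCauchy.LindebergSwap

end
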